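import Summits.QuantumFields.YangMills.Theorems.UnitScaleTiltHistoryTailOneSupplierSplit
import Summits.QuantumFields.YangMills.Theorems.AlphaInputsT3ACv3InnerLiftFineAbelian
import HarnessLib

/-!
# `UnitScaleTiltHistoryTailOneSupplierKinematic` — THE (FL) ROW OF THE 2′χ DISPLAY FROM ONE **RECORD-FREE, COUPLING-FREE KINEMATIC LIFT THEOREM** PER BLOCK SIZE, and
# `HistoryTailL` ⇐ ⟨T8 text⟩ ∧ (that theorem at every odd `L`) ∧ (the (O″χ) rows) — the END-THEOREM TARGET for the (FL) team under OWNER RULING g24-№4 (Newton∕IFT on the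
# (LL) engine: ★w1 LEAD, ★w2 g2, ★w3 (V), ★w4 (N)+(P), ★alpha-2 g5's `exists_linearLift_region`) — cell `ym3-torus`, route `UnitScaleTilt`, crux stmt-QuantumFields-19936
# (v5p9, 2′χ), width seat `ym-ust-19936-w5` (g0); fourth file of the `…HistoryTailOneSupplier` group (p590846, p591256, p591939)

WHY.  The displayed (FL) row `AlphaInputsT3AC.InnerFineLiftsT3 F 𝔠 γ hγ hγ1 K B` speaks the package's language — the record `𝔠`, the coupling window, admissible histories,
`ChargedT3`, `top42Set` — while what the Newton route proves is a statement of LATTICE KINEMATICS in the currency ★alpha-2 g5 already uses for the linear case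
(`AbelianEML.Tensor.exists_linearLift_region`: an arbitrary union `Ω` of level-`k` blocks of `T_η`, data windowed on `plaqsIn k Ω`, exactness on `bondsIn k Ω`, fine plaquettes
on `plaqsIn 0 Ω`).  THIS FILE is the adapter, so that the (FL) team's end theorem can be stated with NO record, NO coupling and NO history:

  KIN(F, K, B, η) := ∀ k ≤ K, ∀ Ω ⊂ Site (F.P K) 0 block-saturated at level k (`w ∈ Ω ↔ toFine k (coarsen k w) ∈ Ω`), ∀ 0 < ε ≤ η, ∀ W : SU(2)-field on the level-k bonds
    with `PlaqSmallOn (plaqsIn k Ω) ε W`: ∃ U on the finest lattice, `(blockAvg ℰp)^k U = W` on `bondsIn k Ω` ∧ `dist1 (U ∂q) < B·ε·L^{−2k}` for every `q ∈ plaqsIn 0 Ω`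

(written inline below; no `def`).  Results:
* §1 `innerFineLiftsT3_of_kinematicLift` — KIN(F, K, B, η) ∧ (every window `ε_W(k) = 2L²·avgWindowFactor·θ(K−k+1) ≤ η`) ⇒ `InnerFineLiftsT3 F 𝔠 γ hγ hγ1 K B` (`Ω_k(h)` is
  block-saturated: ★alpha-2's `mem_Omega_iff_centre`; `ChargedT3`'s second conjunct is the `PlaqSmallOn` datum; `ε_W(k) > 0` by `θBal_pos`); `window_le_of_row` — the record row
  `b₀Q₀(p₀)·(2L²·avgWindowFactor)² ≤ 3C₀(3)·C68·a₁²` gives `ε_W(k) ≤ a₁` for EVERY coupling of the window and all `K, k` (★alpha-1's `MinimiserPin.small_of_C68`) — the k-UNIFORM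
  smallness of the windows is already in the record.
* §2 ★★ `fineLifts_of_kinematicLift` — ONE kinematic theorem `∀ F (F.L = L) K, KIN(F, K, B_K, η)` discharges the per-record (FL) hypothesis `hFL` of
  `…OneSupplierSplit.pinnedPartsT3ACRecFLChi_of_thm1_fineLifts_dataRows` with floor `B_FL := B_K` and ceiling `A_FL := η` (§1 + `innerFineLiftsT3_mono`).
* §3 ★★ `pinnedPartsT3ACRecFLChi_of_thm1_kinematicLift_dataRows` and ★★★ `historyTailL_of_thm1In8_kinematicLift_dataRows_allL` — **`HistoryTailL` ⇐ ⟨v5kC's T8 text⟩ ∧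
  (∀ odd `L > 1`, ∃ B_K, η > 0, ∀ F (F.L = L) K, KIN(F, K, B_K, η)) ∧ (∀ odd `L > 1`, the (O″χ) rows)**.  `B_K` may be anything (`L`-dependent; an `M₁`-dependence is not needed in
  this currency since `Ω` is arbitrary block-saturated — if the Newton route needs the admissible-history geometry after all, §1's proof shows where to restrict `Ω`).
HONEST FRAMING.  Adapter∕bookkeeping over landed theorems; KIN, T8 and the χ data rows are HYPOTHESES, none asserted — in particular (FL) is NOT proved (★alpha-2's `fineLift_abelian`
is the abelian-data case only); def-free; count-neutral helper (`--supports stmt-QuantumFields-19936`); registry untouched.  YM₃ on the three-torus is rung R3 of the programme, NOT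
the Clay problem: nothing here bears on d = 4, infinite volume, or a mass gap.

References: T. Bałaban, Commun. Math. Phys. 102 (1985) 277–309 [Balaban1985Variational] ((2)+(3)+(8) pp.278–279, (11)–(14) pp.279–280, Prop 8 p.304); Commun. Math. Phys. 102
(1985) 255–275 [Balaban1985UV3] ((5) p.256, (7) p.257, (39)–(42) p.266, (47) p.267, (68) p.273, (71) p.273, Thm 2 p.272); Commun. Math. Phys. 109 (1987) 249–301 [Balaban1987RG1]
((0.4) p.253); C. King, Commun. Math. Phys. 102 (1986) 649–677 [King1986] ((3.12) p.657).
-/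

set_option autoImplicit false

noncomputable section

namespace Summit.QuantumFields.YangMills.Theorems.HistoryTailOneSupplier

open MeasureTheory Set
open scoped Matrix.Norms.L2Operator
open Literature.MathematicalPhysics.QuantumFieldTheory.Balaban1983to89
open Literature.MathematicalPhysics.QuantumFieldTheory.Balaban1983to89.T3ContinuumYM3Torus
open Literature.MathematicalPhysics.QuantumFieldTheory.Balaban1983to89.T3UnitLawDensityEML (ℰp)
open Literature.MathematicalPhysics.QuantumFieldTheory.Balaban1983to89.T3UnitScaleTilt (θBal)
open Literature.MathematicalPhysics.QuantumFieldTheory.Balaban1983to89.T3MinimiserStabilityReduction (θBal_pos)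
open Literature.MathematicalPhysics.QuantumFieldTheory.Balaban1983to89.T3PrintedMinimiserExistence (Thm1GlobalMinAt)
open Literature.MathematicalPhysics.QuantumFieldTheory.Balaban1983to89.T3LowerAlongMinimisersSplit (MinimisersIn8At)
open Literature.MathematicalPhysics.QuantumFieldTheory.Balaban1983to89.ExpMeanLog (deltaSU deltaSU_pos)
open Literature.MathematicalPhysics.QuantumFieldTheory.Balaban1983to89.B10Eq38TorusDomains (plaqsIn toFine)
open Literature.MathematicalPhysics.QuantumFieldTheory.Balaban1983to89.B10Eq42TorusConstraint (bondsIn)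
open Literature.MathematicalPhysics.QuantumFieldTheory.Balaban1985CMP102.Setting
open Summit.QuantumFields.Balaban3D.Carriers
open Summit.QuantumFields.Balaban3D.Proofs.Primitives
open Summit.QuantumFields.Balaban3D.Proofs.Thresholds (Q0 Q0_pos)
open B7Prop2Explicit (C0 C0_pos)

/-! ## §1 (FL) for one family and run from a RECORD-FREE kinematic lift theorem and the smallness of the windows -/

/-- **(FL) FOR ONE FAMILY, RECORD, COUPLING AND RUN FROM THE RECORD-FREE KINEMATIC LIFT THEOREM KIN(F, K, B, η) AND THE SMALLNESS OF THE WINDOWS** (`ε_W(k) ≤ η` for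
all `k ≤ K`): at `(k, h, W)` charged, `Ω_k(h)` is a union of level-`k` blocks (`mem_Omega_iff_centre`) and `ChargedT3` supplies `PlaqSmallOn (plaqsIn k Ω_k(h)) ε_W(k) W` with
`0 < ε_W(k)` (`θBal_pos`), so KIN applies verbatim. [cite: Balaban1985Variational, (2)+(8) pp.278–279; Balaban1985UV3, (39)–(42) p.266] -/
theorem innerFineLiftsT3_of_kinematicLift {F : T3Family} {𝔠 : AlphaConsts F.L (suGroupModel 2).N} {γ : ℝ} {hγ : 0 < γ}
    {hγ1 : γ ≤ (min 𝔠.gamma0 1) ^ 2} {K : ℕ} {B η : ℝ}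
    (hkin : ∀ (k : ℕ), k ≤ K → ∀ (Ω : Set (Site (F.P K) 0)), (∀ w : Site (F.P K) 0, w ∈ Ω ↔ toFine k (coarsen k w) ∈ Ω) →
        ∀ (ε : ℝ), 0 < ε → ε ≤ η → ∀ (W : GaugeField (F.P K) k (Matrix.specialUnitaryGroup (Fin 2) ℂ)), PlaqSmallOn (↑(plaqsIn k Ω)) ε W →
          ∃ U : GaugeField (F.P K) 0 (Matrix.specialUnitaryGroup (Fin 2) ℂ),
            (∀ b : PBond (F.P K) k, b ∈ bondsIn k Ω → Averaging.iter (fun i => BlockAveraging.blockAvg (P := F.P K) (j := i) ℰp) k U b = W b) ∧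
            ∀ q : Plaq (F.P K) 0, q ∈ plaqsIn 0 Ω → GaugeGroup.dist1 (GaugeField.plaqHol U q) < B * ε * (((F.L : ℝ) ^ k)⁻¹) ^ 2)
    (hwin : ∀ k : ℕ, k ≤ K → 2 * (F.L : ℝ) ^ 2 * avgWindowFactor F.L * θBal F.L γ 𝔠.b₀ 𝔠.p₀ (K - k + 1) ≤ η) :
    AlphaInputsT3AC.InnerFineLiftsT3 F 𝔠 γ hγ hγ1 K B := by
  intro k hk h _ _ W hW
  have hΩ := fun w => AlphaInputsT3AC.mem_Omega_iff_centre (hγ := hγ) (hγ1 := hγ1) hk h w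
  have hε : 0 < 2 * (F.L : ℝ) ^ 2 * avgWindowFactor F.L * θBal F.L γ 𝔠.b₀ 𝔠.p₀ (K - k + 1) := by
    have hA := avgWindowFactor_pos F
    have hθ : 0 < θBal F.L γ 𝔠.b₀ 𝔠.p₀ (K - k + 1) :=
      θBal_pos F.hL.2.le hγ (hγ1.trans (sq_min_one_le _ 𝔠.gamma0_pos)) 𝔠.b₀_pos 𝔠.p₀ _
    have hL : (0 : ℝ) < F.L := by exact_mod_cast (zero_lt_one.trans F.hL.2)
    positivity
  exact hkin k hk _ hΩ _ hε (hwin k hk) W hW.2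

/-- **THE WINDOWS ARE k-UNIFORMLY SMALL ON THE RECORD**: the row `b₀Q₀(p₀)·(2L²·avgWindowFactor)² ≤ 3C₀(3)·C68·a₁²` gives `ε_W(k) = 2L²·avgWindowFactor·θ(K−k+1) ≤ a₁` for every
coupling `γ ≤ (min γ₀ 1)²` and all `K, k` (★alpha-1's `MinimiserPin.small_of_C68` at `B := avgWindowFactor L`). [cite: Balaban1985UV3, (7) p.257, (40) p.266 and (68)–(71) p.273] -/
theorem window_le_of_row {F : T3Family} (𝔠 : AlphaConsts F.L (suGroupModel 2).N) {a₁ : ℝ} (ha₁ : 0 < a₁)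
    (hCa : (𝔠.b₀ * Q0 𝔠.p₀) * (2 * (F.L : ℝ) ^ 2 * avgWindowFactor F.L) ^ 2 ≤ 3 * C0 3 * 𝔠.C68 * a₁ ^ 2)
    {γ : ℝ} (hγ : 0 < γ) (hγ1 : γ ≤ (min 𝔠.gamma0 1) ^ 2) (K k : ℕ) :
    2 * (F.L : ℝ) ^ 2 * avgWindowFactor F.L * θBal F.L γ 𝔠.b₀ 𝔠.p₀ (K - k + 1) ≤ a₁ :=
  MinimiserPin.small_of_C68 𝔠 F.hL.2.le ha₁ (avgWindowFactor_pos F) hCa γ hγ hγ1 K k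

/-! ## §2 The per-record (FL) hypothesis of `…OneSupplierSplit` from ONE kinematic lift theorem per block size -/

/-- ★★ **ONE KINEMATIC LIFT THEOREM PER BLOCK SIZE DISCHARGES THE PER-RECORD (FL) HYPOTHESIS OF `…OneSupplierSplit`** (floor `B_FL := B_K`, ceiling `A_FL := η`): for every
record with `B_K ≤ B₃` and every `0 < a₁ ≤ η` carrying the window row, (FL) at `B₃` for every family of block size `L`, coupling and run (§1 with `ε_W(k) ≤ a₁ ≤ η`, then
`innerFineLiftsT3_mono`).  The other record rows in the hypothesis list are accepted and unused (they are what `…OneSupplierSplit` offers).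
[cite: Balaban1985Variational, Thm 1 (8) p.279; Balaban1985UV3, (7) p.257, (40)–(42) p.266, (68) p.273] -/
theorem fineLifts_of_kinematicLift {L : ℕ} {B_K η : ℝ}
    (hkin : ∀ (F : T3Family) (_hF : F.L = L) (K : ℕ), ∀ (k : ℕ), k ≤ K → ∀ (Ω : Set (Site (F.P K) 0)), (∀ w : Site (F.P K) 0, w ∈ Ω ↔ toFine k (coarsen k w) ∈ Ω) →
        ∀ (ε : ℝ), 0 < ε → ε ≤ η → ∀ (W : GaugeField (F.P K) k (Matrix.specialUnitaryGroup (Fin 2) ℂ)), PlaqSmallOn (↑(plaqsIn k Ω)) ε W →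
          ∃ U : GaugeField (F.P K) 0 (Matrix.specialUnitaryGroup (Fin 2) ℂ),
            (∀ b : PBond (F.P K) k, b ∈ bondsIn k Ω → Averaging.iter (fun i => BlockAveraging.blockAvg (P := F.P K) (j := i) ℰp) k U b = W b) ∧
            ∀ q : Plaq (F.P K) 0, q ∈ plaqsIn 0 Ω → GaugeGroup.dist1 (GaugeField.plaqHol U q) < B_K * ε * (((F.L : ℝ) ^ k)⁻¹) ^ 2) :
    ∀ (𝔠 : AlphaConsts L (suGroupModel 2).N) (a₁ : ℝ), B_K ≤ 𝔠.B₃ → 1 ≤ 2 * 𝔠.B₃ → 0 < a₁ → a₁ ≤ η →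
      (143 * ((((3 + 4 : ℕ) : ℝ)) ^ 2 / 4) ^ 2) * (2 * (𝔠.B₃ * a₁)) ≤ 1 / 3 →
      2 * (2 * (𝔠.B₃ * a₁)) ≤ 2 * deltaSU (Fin 2) / (((3 + 4) * L : ℕ) : ℝ) ^ 2 →
      4 * 𝔠.B₃ * (L : ℝ) ^ 2 * avgWindowFactor L ≤ 𝔠.C68 →
      Real.exp (𝔠.p₀ - 1) ≤ 3 * C0 3 * 𝔠.C68 * (𝔠.b₀ * Q0 𝔠.p₀) →
      (𝔠.b₀ * Q0 𝔠.p₀) * (2 * (L : ℝ) ^ 2 * avgWindowFactor L) ^ 2 ≤ 3 * C0 3 * 𝔠.C68 * a₁ ^ 2 →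
      7 * L + 3 ≤ 𝔠.M₁ →
      ∀ (F : T3Family) (hF : F.L = L) (γ : ℝ) (hγ : 0 < γ) (hγ1 : γ ≤ (min (hF ▸ 𝔠).gamma0 1) ^ 2) (K : ℕ),
        AlphaInputsT3AC.InnerFineLiftsT3 F (hF ▸ 𝔠) γ hγ hγ1 K (hF ▸ 𝔠).B₃ := by
  intro 𝔠 a₁ hB _ ha₁ haη _ _ _ _ hCa _ F hF γ hγ hγ1 K
  subst hF
  exact innerFineLiftsT3_mono
    (innerFineLiftsT3_of_kinematicLift (hkin F rfl K) fun k _ => (window_le_of_row 𝔠 ha₁ hCa hγ hγ1 K k).trans haη) hB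

/-! ## §3 The display and the crux from (T), ONE record-free kinematic lift theorem per block size, and the (O″χ) rows -/

/-- ★★ **THE 2′χ DISPLAY OF RECORD FROM (T) AT ANY CONSTANTS, ONE RECORD-FREE KINEMATIC LIFT THEOREM AND THE (O″χ) ROWS** (`…OneSupplierSplit.pinnedPartsT3ACRecFLChi_of_thm1_fineLifts_dataRows`
∘ §2). [cite: Balaban1985Variational, Thm 1 (6)–(8) pp.278–279; Balaban1985UV3, (7) p.257, (40)–(42) p.266, (47) p.267, (68) p.273 and Thm 2 p.272] -/
theorem pinnedPartsT3ACRecFLChi_of_thm1_kinematicLift_dataRows {L : ℕ} (hL : 1 < L)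
    (hT : ∃ a₀ a₁ B₃ : ℝ, 0 < a₀ ∧ 0 < a₁ ∧ 0 < B₃ ∧ Thm1GlobalMinAt L a₀ a₁ B₃)
    {B_K η : ℝ} (hη : 0 < η)
    (hkin : ∀ (F : T3Family) (_hF : F.L = L) (K : ℕ), ∀ (k : ℕ), k ≤ K → ∀ (Ω : Set (Site (F.P K) 0)), (∀ w : Site (F.P K) 0, w ∈ Ω ↔ toFine k (coarsen k w) ∈ Ω) →
        ∀ (ε : ℝ), 0 < ε → ε ≤ η → ∀ (W : GaugeField (F.P K) k (Matrix.specialUnitaryGroup (Fin 2) ℂ)), PlaqSmallOn (↑(plaqsIn k Ω)) ε W →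
          ∃ U : GaugeField (F.P K) 0 (Matrix.specialUnitaryGroup (Fin 2) ℂ),
            (∀ b : PBond (F.P K) k, b ∈ bondsIn k Ω → Averaging.iter (fun i => BlockAveraging.blockAvg (P := F.P K) (j := i) ℰp) k U b = W b) ∧
            ∀ q : Plaq (F.P K) 0, q ∈ plaqsIn 0 Ω → GaugeGroup.dist1 (GaugeField.plaqHol U q) < B_K * ε * (((F.L : ℝ) ^ k)⁻¹) ^ 2)
    {B₀ A₀ A₁ : ℝ} (hA₀ : 0 < A₀) (hA₁ : 0 < A₁)
    (hO : ∀ (B a₀ a₁ : ℝ), B₀ ≤ B → 1 ≤ 2 * B → 0 < a₀ → a₀ ≤ A₀ → 0 < a₁ → a₁ ≤ A₁ → B * a₁ ≤ a₀ →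
        (143 * ((((3 + 4 : ℕ) : ℝ)) ^ 2 / 4) ^ 2) * (2 * (B * a₁)) ≤ 1 / 3 →
        2 * (2 * (B * a₁)) ≤ 2 * deltaSU (Fin 2) / (((3 + 4) * L : ℕ) : ℝ) ^ 2 →
        Thm1GlobalMinAt L a₀ a₁ B →
        ∃ (b₁ p₁ : ℝ), ∀ (b₀ p₀ : ℝ), b₁ ≤ b₀ → p₁ ≤ p₀ →
          ∃ 𝔠 : AlphaConsts L (suGroupModel 2).N, 𝔠.b₀ = b₀ ∧ 𝔠.p₀ = p₀ ∧ 𝔠.B₃ = B ∧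
            4 * 𝔠.B₃ * (L : ℝ) ^ 2 * avgWindowFactor L ≤ 𝔠.C68 ∧
            Real.exp (𝔠.p₀ - 1) ≤ 3 * C0 3 * 𝔠.C68 * (𝔠.b₀ * Q0 𝔠.p₀) ∧
            (𝔠.b₀ * Q0 𝔠.p₀) * (2 * (L : ℝ) ^ 2 * avgWindowFactor L) ^ 2 ≤ 3 * C0 3 * 𝔠.C68 * a₁ ^ 2 ∧
            7 * L + 3 ≤ 𝔠.M₁ ∧
            ∀ (F : T3Family) (hF : F.L = L),
              (∀ (γ : ℝ) (hγ : 0 < γ) (hγ1 : γ ≤ (min (hF ▸ 𝔠).gamma0 1) ^ 2) (K : ℕ),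
                (∃ Ut : (k : ℕ) → GaugeField (F.P K) k (Matrix.specialUnitaryGroup (Fin 2) ℂ) →
                    GaugeField (F.P K) 0 (Matrix.specialUnitaryGroup (Fin 2) ℂ),
                  AlphaInputsT3AC.TrivMinimiserRowsT3 F (hF ▸ 𝔠) γ hγ hγ1 a₀ a₁ K Ut) →
                ∃ Ut : (k : ℕ) → GaugeField (F.P K) k (Matrix.specialUnitaryGroup (Fin 2) ℂ) →
                    GaugeField (F.P K) 0 (Matrix.specialUnitaryGroup (Fin 2) ℂ),
                  AlphaInputsT3AC.TrivMinimiserRowsT3 F (hF ▸ 𝔠) γ hγ hγ1 a₀ a₁ K Ut ∧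
                    AlphaInputsT3AC.DataRowsT3XChi F (hF ▸ 𝔠) γ hγ hγ1 K Ut)) :
    AlphaInputsT3AC.PinnedPartsT3ACRecFLChi L :=
  pinnedPartsT3ACRecFLChi_of_thm1_fineLifts_dataRows hL hT hη (fineLifts_of_kinematicLift hkin) hA₀ hA₁ hO

/-- ★★★ **`HistoryTailL` ⇐ ⟨v5kC's T8 TEXT⟩ ∧ (∀ odd `L > 1`, ∃ B_K, η > 0, ∀ F (F.L = L) K, KIN(F, K, B_K, η)) ∧ (∀ odd `L > 1`, THE (O″χ) ROWS)** — stmt-QuantumFields-19936 BY NAME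
with the (FL) deliverable stated as pure lattice kinematics (no record, no coupling, no history; `Ω` any union of level-`k` blocks), the (T) deliverable as 19200's T8 text (compose
★r1 g5's `thm1In8GlobalMin_of_v8Leaves(4)`∕`_v9Leaves`) and the (O″χ) deliverable in `hrows`-shape for NODE O's own records.
[cite: Balaban1985UV3, (5) p.256, (47) p.267, (71) p.273 and Thm 2 p.272; Balaban1985Variational, (2)+(8) pp.278–279 and Prop 8 p.304; King1986, (3.12) p.657] -/
theorem historyTailL_of_thm1In8_kinematicLift_dataRows_allL
    (hT8 : ∀ L : ℕ, Odd L → 1 < L → ∃ a₀ a₁ B₃ : ℝ, 0 < a₀ ∧ 0 < a₁ ∧ 0 < B₃ ∧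
      Thm1GlobalMinAt L a₀ a₁ B₃ ∧ MinimisersIn8At L a₀ a₁ B₃)
    (hkin : ∀ L : ℕ, Odd L → 1 < L → ∃ (B_K η : ℝ), 0 < η ∧
      ∀ (F : T3Family) (_hF : F.L = L) (K : ℕ), ∀ (k : ℕ), k ≤ K → ∀ (Ω : Set (Site (F.P K) 0)), (∀ w : Site (F.P K) 0, w ∈ Ω ↔ toFine k (coarsen k w) ∈ Ω) →
        ∀ (ε : ℝ), 0 < ε → ε ≤ η → ∀ (W : GaugeField (F.P K) k (Matrix.specialUnitaryGroup (Fin 2) ℂ)), PlaqSmallOn (↑(plaqsIn k Ω)) ε W →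
          ∃ U : GaugeField (F.P K) 0 (Matrix.specialUnitaryGroup (Fin 2) ℂ),
            (∀ b : PBond (F.P K) k, b ∈ bondsIn k Ω → Averaging.iter (fun i => BlockAveraging.blockAvg (P := F.P K) (j := i) ℰp) k U b = W b) ∧
            ∀ q : Plaq (F.P K) 0, q ∈ plaqsIn 0 Ω → GaugeGroup.dist1 (GaugeField.plaqHol U q) < B_K * ε * (((F.L : ℝ) ^ k)⁻¹) ^ 2)
    (hO : ∀ L : ℕ, Odd L → 1 < L → ∃ (B₀ A₀ A₁ : ℝ), 0 < A₀ ∧ 0 < A₁ ∧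
      ∀ (B a₀ a₁ : ℝ), B₀ ≤ B → 1 ≤ 2 * B → 0 < a₀ → a₀ ≤ A₀ → 0 < a₁ → a₁ ≤ A₁ → B * a₁ ≤ a₀ →
        (143 * ((((3 + 4 : ℕ) : ℝ)) ^ 2 / 4) ^ 2) * (2 * (B * a₁)) ≤ 1 / 3 →
        2 * (2 * (B * a₁)) ≤ 2 * deltaSU (Fin 2) / (((3 + 4) * L : ℕ) : ℝ) ^ 2 →
        Thm1GlobalMinAt L a₀ a₁ B →
        ∃ (b₁ p₁ : ℝ), ∀ (b₀ p₀ : ℝ), b₁ ≤ b₀ → p₁ ≤ p₀ →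
          ∃ 𝔠 : AlphaConsts L (suGroupModel 2).N, 𝔠.b₀ = b₀ ∧ 𝔠.p₀ = p₀ ∧ 𝔠.B₃ = B ∧
            4 * 𝔠.B₃ * (L : ℝ) ^ 2 * avgWindowFactor L ≤ 𝔠.C68 ∧
            Real.exp (𝔠.p₀ - 1) ≤ 3 * C0 3 * 𝔠.C68 * (𝔠.b₀ * Q0 𝔠.p₀) ∧
            (𝔠.b₀ * Q0 𝔠.p₀) * (2 * (L : ℝ) ^ 2 * avgWindowFactor L) ^ 2 ≤ 3 * C0 3 * 𝔠.C68 * a₁ ^ 2 ∧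
            7 * L + 3 ≤ 𝔠.M₁ ∧
            ∀ (F : T3Family) (hF : F.L = L),
              (∀ (γ : ℝ) (hγ : 0 < γ) (hγ1 : γ ≤ (min (hF ▸ 𝔠).gamma0 1) ^ 2) (K : ℕ),
                (∃ Ut : (k : ℕ) → GaugeField (F.P K) k (Matrix.specialUnitaryGroup (Fin 2) ℂ) →
                    GaugeField (F.P K) 0 (Matrix.specialUnitaryGroup (Fin 2) ℂ),
                  AlphaInputsT3AC.TrivMinimiserRowsT3 F (hF ▸ 𝔠) γ hγ hγ1 a₀ a₁ K Ut) →
                ∃ Ut : (k : ℕ) → GaugeField (F.P K) k (Matrix.specialUnitaryGroup (Fin 2) ℂ) →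
                    GaugeField (F.P K) 0 (Matrix.specialUnitaryGroup (Fin 2) ℂ),
                  AlphaInputsT3AC.TrivMinimiserRowsT3 F (hF ▸ 𝔠) γ hγ hγ1 a₀ a₁ K Ut ∧
                    AlphaInputsT3AC.DataRowsT3XChi F (hF ▸ 𝔠) γ hγ hγ1 K Ut)) :
    Summit.QuantumFields.YangMills.Theses.UnitScaleTilt.HistoryTailL := by
  refine historyTailL_of_thm1In8_fineLifts_dataRows_allL hT8 (fun L hLo hL => ?_) hO
  obtain ⟨B_K, η, hη, h⟩ := hkin L hLo hL
  exact ⟨B_K, η, hη, fineLifts_of_kinematicLift h⟩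

end Summit.QuantumFields.YangMills.Theorems.HistoryTailOneSupplier

end
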